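import Summits.ABC.IUTFork.Joshi.ThetaJoshiLocusBE
import Summits.ABC.IUTFork.Joshi.Enlargements
import HarnessLib

/-!
# Joshi, ATS III §6.7–§6.10: enlargement, `B_dR`, non-degeneracy, and the ADELIC theta-values locus `Θ̃^{B_{L′}}_Joshi` (file 2 of 2)

Record-only TYPING file of the abc-iut cell, block E («type Joshi's construction, test vs S», rung LADDER-ABC:A2.E),
seat abc-iut-E-t11, slot T-11 (OBJECTS.tsv O-022 / O-023; node ids J3:Thm6.7.1, J3:Thm6.7.1.1, J3:Rmk6.7.1.2, J3:Thm6.8.1,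
J3:Def6.8.3, J3:Lem6.9.1, §6.9.1, J3:Def6.10.2, (6.10.4), §6.10.1, §6.10.2); file 2 of 2, over the adelic family
`ATS3.AdelicLiftDatum` of `Joshi/ThetaJoshiLocusBE.lean` (same seat; merge-debts listed there) and slot T-10's carriers.
Source: K. Joshi, *Construction of Arithmetic Teichmüller Spaces III*, arXiv:2401.13508 **v4** (unrefereed) = bib
`Joshi2024ATS3`; locators «p.N l.a–b» = PDF page N, lines a–b of `HOME/lit/renders/Joshi-arxiv-2401.13508/pNNNN.txt`. TAKES
NO SIDE on [IUTchIII] Cor. 3.12, on Joshi's claims, or on Mochizuki's report on them; typed ≠ proved; typed AS A CANDIDATE ≠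
endorsed; asserted-in-print statements are `@[claim "Joshi2024ATS3" "disputed"]` `Prop` defs, never asserted; properties
that follow from the signature are proved («discharged»).

CONTENTS:
* §4 §6.7 the ENLARGEMENT, typed with slot T-09's LANDED generic §5.3 operators (`Joshi/Enlargements.lean`, abc-iut-E-t9:
  `fullEnlargement O G φ S = closedConvexHull O (frobEnlargement φ (autEnlargement G S))`, `Aut(G_E)`-enlargement
  (5.3.1.2) → Frobenius stabilisation (5.3.2.1) → closed convex hull §5.3.3, in the printed order) on `M = B_E^{ℓ⋇}` with
  the diagonal action of `G_E` (section parameter `Γ` with its `MulAction`), the coordinatewise Frobenius of file 1's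
  datum (`frobPerm`) and scalars `O_E`; Thm. 6.7.1 (1)(2)(3) as a claim-Prop AND DERIVED (`thm671_of`) from T-09's
  `smul_fullEnlargement` / `image_fullEnlargement` / `autEnlargement_eq_self_of_stable` under the natural hypotheses
  («`G_E` acts by `O_E`-linear homeomorphisms commuting with `φ`», «`φ` is an `O_E`-linear homeomorphism»); §6.7.1 / Thm.
  6.7.1.1 / Rmk. 6.7.1.2 the variant rings (index type only — «properties similar to those established above» is not a
  statement). File 1's interim §5.3 fields (`G`, `galAct`, `AutG`, `autId`, `twist`, `subset_twist_autId`, `conv`) are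
  SUPERSEDED by T-09's operators and not read here (only `frob` is);
* §5 Thm. 6.8.1 / Def. 6.8.3 embedding in `B_dR` (PROVED from (5.2.4.1)); Lem. 6.9.1 non-degeneracy (PROVED, over T-10's
  fields `absK_teich`, `m_isMaximal` and file 1's `absK_zero`, `absK_xi_pos`);
* §6 §6.9.1 the adelic rings `B_{L′}`, `B̃_{L′}`; Def. 6.10.2 THE ADELIC LOCUS `Θ̃^{B_{L′}}_Joshi` (via T-10's `adelicLocus`),
  (6.10.4), local components (PROVED ⊆, and = `Θ̃^{B_E}_Joshi` granted lifts exist); §6.10.2 descent to `L_mod`;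
* §6.10.1 «elements `Ξ_z` as Mochizuki's Θ-pilot objects» is PROSE (p. 53 l. 11–18), recorded in the closing section
  docstring: the typed dictionary Prop binding `Ξ_z` to OUR `Thm311.MRData.Ψ` (E-PLAN §3 row D-03) is `Dictionary.datum` /
  `BaseIsThetaPilot` of `Joshi/Dictionary.lean` (ruling R4b) — this file imports NOTHING of our side (DEFS-FREEZE).
For slot T-12 (`FundamentalEstimateBL.lean`, interim `ATS3.AdelicThetaDatum`): `Tuple`, `thetaLocusBL`, `trivialLift`,
`mem_thetaLocusBL_iff`, `apply_eq_trivialLift_of_mem` are the `Idx`/`Xi`/`Xi_off`/`locus` data of the re-keying.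
-/

noncomputable section

open Set

namespace Summit.ABC.IUTFork.Joshi.ATS3

namespace AdelicLiftDatum

variable {A : CollationDatum} {OE B : A.V → Type} [∀ w, CommRing (OE w)] [∀ w, CommRing (B w)]
  [∀ w, Algebra (OE w) (B w)] (𝔇 : AdelicLiftDatum A OE B)

/-! ## §4 §6.7 — enlargement (the §5.3 procedures of slot T-09) and Theorem 6.7.1; §6.7.1 variants -/

/-- The Frobenius `φ` of `B_E` acting coordinatewise on `B_E^{ℓ⋇}` (§5.3.2 «This obviously applies to subsets of `B_E^{ℓ⋇}`»,
p. 41 l. 32–33), as a permutation (from file 1's field `frob`). [claim: Joshi2024ATS3, status: disputed] -/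
def frobPerm (w : A.V) : Equiv.Perm (Fin A.lstar → B w) := Equiv.piCongrRight fun _ => (𝔇.frob w).toEquiv

/-- `frobPerm` is `φ` in each coordinate. [folklore] -/
theorem frobPerm_apply (w : A.V) (Ξ : Fin A.lstar → B w) (j : Fin A.lstar) : 𝔇.frobPerm w Ξ j = 𝔇.frob w (Ξ j) := rfl

section Enlargement

open scoped Pointwise

variable [∀ w, TopologicalSpace (B w)] (Γ : A.V → Type) [∀ w, Group (Γ w)] [∀ w, MulAction (Γ w) (B w)]

/-- **The BASIC THETA-VALUES LOCUS for the ring `B_E`** (§6.7, p. 49 l. 77–85: «Now one applies the enlargement procedures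
§5.3 to the set `Θ̃^{B_E}_Joshi` defined in Definition 6.6.1.1 … This enlarged set will again be denoted by `Θ̃^{B_E}_Joshi` … will be
called the basic theta-values locus for the ring `B_E`»): slot T-09's `fullEnlargement` (closed convex hull ∘ Frobenius
stabilisation ∘ `Aut(G_E)`-enlargement, §5.3.3 p. 41 l. 35–36) of the Def. 6.6.1.1 locus, for the Galois group `Γ w = G_{E′_w}`
acting diagonally on `B_{E′_w}^{ℓ⋇}`, the coordinatewise Frobenius and the scalars `O_{E′_w}` (Fréchet topology = the section's
topology on `B_{E′_w}`). [claim: Joshi2024ATS3, status: disputed] -/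
def thetaLocusBEenl (w : A.V) : Set (Fin A.lstar → B w) :=
  fullEnlargement (OE w) (Γ w) (𝔇.frobPerm w) (𝔇.thetaLocusBE w)

/-- The Def. 6.6.1.1 locus lies in the basic theta-values locus (Rmk. 5.3.3.1: enlargements add elements). [folklore] -/
theorem thetaLocusBE_subset_thetaLocusBEenl (w : A.V) : 𝔇.thetaLocusBE w ⊆ 𝔇.thetaLocusBEenl Γ w :=
  subset_fullEnlargement (OE w) (Γ w) (𝔇.frobPerm w) _

/-- «Galois stable for `G_{E′_w}`» (Thm. 6.7.1 (1)): `g·S ⊆ S` for the diagonal action. [claim: Joshi2024ATS3, status: disputed] -/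
def GalStable (_𝔇 : AdelicLiftDatum A OE B) (w : A.V) (S : Set (Fin A.lstar → B w)) : Prop := ∀ g : Γ w, g • S ⊆ S

/-- «`φ`-stable» (Thm. 6.7.1 (2)): `φ(S) ⊆ S` for the coordinatewise Frobenius. [claim: Joshi2024ATS3, status: disputed] -/
def FrobStable (w : A.V) (S : Set (Fin A.lstar → B w)) : Prop := ⇑(𝔇.frobPerm w) '' S ⊆ S

/-- «`Aut(G_{E′_w})`-stable in the sense of earlier definitions» (Thm. 6.7.1 (3); §5.3.1 (5.3.1.2)): the `Aut(G_E)`-enlargement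
`⋃_σ S^σ` (slot T-09's literal reading `autEnlargement`) adds nothing to `S`. [claim: Joshi2024ATS3, status: disputed] -/
def AutStable (_𝔇 : AdelicLiftDatum A OE B) (w : A.V) (S : Set (Fin A.lstar → B w)) : Prop := autEnlargement (Γ w) S ⊆ S

/-- **[J-III] Theorem 6.7.1 (p. 49 l. 86 – p. 50 l. 3)**: «for each `w ∈ V^{odd,ss}_p` and with `E = E′_w = L′_w` one has a basic
theta-values locus `Θ̃^{B_{E′_w}}_Joshi = Θ̃^{B_{L′_w}}_Joshi` [which] is (1) Galois stable for `G_{E′_w}`, (2) `φ`-stable for where `φ` is the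
Frobenius of `B_{E′_w}`, (3) and also `Aut(G_{E′_w})`-stable in the sense of earlier definitions. Proof. The proof is clear by
construction and the definitions.» A `Prop`-valued definition, NOT asserted; DERIVED below (`thm671_of`) from slot T-09's
stability theorems under the hypotheses that make «clear by construction» go through. -/
@[claim "Joshi2024ATS3" "disputed"]
def Thm671 : Prop :=
  ∀ w ∈ A.Voddss, 𝔇.GalStable Γ w (𝔇.thetaLocusBEenl Γ w) ∧ 𝔇.FrobStable w (𝔇.thetaLocusBEenl Γ w) ∧
    𝔇.AutStable Γ w (𝔇.thetaLocusBEenl Γ w)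

omit [∀ w, TopologicalSpace (B w)] in
/-- Thm. 6.7.1 (3) follows from (1): on a `G_E`-stable set the literal `Aut(G_E)`-enlargement adds nothing (slot T-09's
`autEnlargement_eq_self_of_stable`). [folklore] -/
theorem autStable_of_galStable {w : A.V} {S : Set (Fin A.lstar → B w)} (h : 𝔇.GalStable Γ w S) : 𝔇.AutStable Γ w S :=
  (autEnlargement_eq_self_of_stable h).le

/-- Thm. 6.7.1 (1) DERIVED: if every `g ∈ G_E` acts on `B_E^{ℓ⋇}` as an `O_E`-linear homeomorphism commuting with `φ` (T-09's
`smul_fullEnlargement`), the basic theta-values locus is Galois stable. [folklore] -/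
theorem galStable_thetaLocusBEenl_of {w : A.V} (L : Γ w → ((Fin A.lstar → B w) ≃L[OE w] (Fin A.lstar → B w)))
    (hL : ∀ (g : Γ w) (m : Fin A.lstar → B w), L g m = g • m)
    (hcomm : ∀ (g : Γ w) (m : Fin A.lstar → B w), g • 𝔇.frobPerm w m = 𝔇.frobPerm w (g • m)) :
    𝔇.GalStable Γ w (𝔇.thetaLocusBEenl Γ w) := fun g =>
  (smul_fullEnlargement (OE w) (Γ w) (𝔇.frobPerm w) L hL hcomm (𝔇.thetaLocusBE w) g).le

/-- Thm. 6.7.1 (2) DERIVED: if the coordinatewise Frobenius is (the permutation underlying) an `O_E`-linear homeomorphism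
(T-09's `image_fullEnlargement`), the basic theta-values locus is `φ`-stable. [folklore] -/
theorem frobStable_thetaLocusBEenl_of {w : A.V} (e : (Fin A.lstar → B w) ≃L[OE w] (Fin A.lstar → B w))
    (he : (e : (Fin A.lstar → B w) ≃ (Fin A.lstar → B w)) = 𝔇.frobPerm w) :
    𝔇.FrobStable w (𝔇.thetaLocusBEenl Γ w) := by
  unfold FrobStable thetaLocusBEenl
  rw [← he]
  exact (image_fullEnlargement (OE w) (Γ w) e (𝔇.thetaLocusBE w)).le

/-- **Thm. 6.7.1 DERIVED** («clear by construction and the definitions»): at every `w ∈ V^{odd,ss}`, given that `G_{E′_w}` acts on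
`B_{E′_w}^{ℓ⋇}` by `O_{E′_w}`-linear homeomorphisms commuting with the Frobenius and that the Frobenius is an `O_{E′_w}`-linear
homeomorphism (properties of slot T-09's rings, taken here as explicit hypotheses), (1), (2), (3) hold. [folklore] -/
theorem thm671_of
    (hL : ∀ w ∈ A.Voddss, ∃ L : Γ w → ((Fin A.lstar → B w) ≃L[OE w] (Fin A.lstar → B w)),
      (∀ (g : Γ w) (m : Fin A.lstar → B w), L g m = g • m) ∧
        ∀ (g : Γ w) (m : Fin A.lstar → B w), g • 𝔇.frobPerm w m = 𝔇.frobPerm w (g • m))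
    (he : ∀ w ∈ A.Voddss, ∃ e : (Fin A.lstar → B w) ≃L[OE w] (Fin A.lstar → B w),
      (e : (Fin A.lstar → B w) ≃ (Fin A.lstar → B w)) = 𝔇.frobPerm w) :
    𝔇.Thm671 Γ := fun w hw => by
  obtain ⟨L, hL1, hL2⟩ := hL w hw
  obtain ⟨e, hee⟩ := he w hw
  have h1 := 𝔇.galStable_thetaLocusBEenl_of Γ L hL1 hL2
  exact ⟨h1, 𝔇.frobStable_thetaLocusBEenl_of Γ e hee, 𝔇.autStable_of_galStable Γ h1⟩

/-- **[J-III] §6.7.1 + Theorem 6.7.1.1 + Rmk. 6.7.1.2 (p. 50 l. 4 – p. 51 l. 17), the VARIANT RINGS `B?`**: «Let `B?` be any one of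
`{B, B[1/t], B_E, B̃_E, B_E[1/t], B̃_E[1/t]} ∪ {B_I, B_I ⊗_{E_0} E : I ⊂ [0,1] ⊂ ℝ}`. Then one can construct the theta-values-locus `Θ̃^{B?}_Joshi ⊂
B?^{ℓ⋇}` satisfying properties similar to those established above» (`B_I` of [FF18 Déf. 1.6.2], `B = B_{(0,1)}`; `t ∈ B` of [FF18 10.1.1];
`B̃_E = B ⊗_{ℚ_p} E = B_E^{⊕[E_0:ℚ_p]}` by (5.2.5.3); Rmk. 6.7.1.2: «the rings in the second set have more complicated behavior with respect
to Frobenius»). «Properties similar to those established above» is not a statement: ONLY the index of variants is typed (no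
`Prop`); of the variants only `B̃_E` ((6.10.4)) and `B_dR` (§6.8) are carried, as bare fields of file 1.
[claim: Joshi2024ATS3, status: disputed] -/
inductive VariantRing : Type
  /-- `B = B_{ℂ_p^♭,ℚ_p} = B_{(0,1)}` -/
  | base
  /-- `B[1/t]` -/
  | baseInvT
  /-- `B_E` -/
  | BE
  /-- `B̃_E = B ⊗_{ℚ_p} E` -/
  | BEtil
  /-- `B_E[1/t]` -/
  | BEInvT
  /-- `B̃_E[1/t]` -/
  | BEtilInvT
  /-- `B_I`, `I ⊂ [0,1]` an interval -/
  | BI (I : Set ℝ)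
  /-- `B_I ⊗_{E_0} E` -/
  | BItensorE (I : Set ℝ)

/-! ## §5 Theorem 6.8.1 / Definition 6.8.3 — embedding in `B_dR`; Lemma 6.9.1 — non-degeneracy -/

/-- `B_E^{ℓ⋇} → B_dR^{ℓ⋇}`, coordinatewise ((6.8.2)). [claim: Joshi2024ATS3, status: disputed] -/
def toBdRTuple (w : A.V) (Ξ : Fin A.lstar → B w) : Fin A.lstar → 𝔇.BdR w := fun j => 𝔇.toBdR w (Ξ j)

omit [∀ w, TopologicalSpace (B w)] in
/-- `B_E^{ℓ⋇} ↪ B_dR^{ℓ⋇}` is injective (from (5.2.4.1)). [folklore] -/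
theorem toBdRTuple_injective (w : A.V) : Function.Injective (𝔇.toBdRTuple w) := fun _ _ h =>
  funext fun j => 𝔇.toBdR_injective w (congr_fun h j)

/-- **[J-III] Theorem 6.8.1 (p. 51 l. 25–35)**: «Let `w ∈ V^{odd,ss}` and write `E = E′_w = L′_w`. One has an embedding (6.8.2)
`Θ̃^{B_E}_Joshi ⊂ B_E^{ℓ⋇} ↪ B_dR^{ℓ⋇}`. Proof. This is immediate from the fact (5.2.4.1) that `B_E ↪ B_dR`.» PROVED over the signature (at every
`w`): the coordinatewise map is injective on the basic theta-values locus. [claim: Joshi2024ATS3, status: disputed] -/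
theorem thm681 (w : A.V) : InjOn (𝔇.toBdRTuple w) (𝔇.thetaLocusBEenl Γ w) := (𝔇.toBdRTuple_injective w).injOn

/-- **[J-III] Definition 6.8.3 (p. 51 l. 36–41)**: «Write `Θ̃^{B_dR}_Joshi` for the image of `Θ̃^{B_E}_Joshi` in `B_dR^{ℓ⋇}`.»
[claim: Joshi2024ATS3, status: disputed] -/
def thetaLocusBdR (w : A.V) : Set (Fin A.lstar → 𝔇.BdR w) := 𝔇.toBdRTuple w '' 𝔇.thetaLocusBEenl Γ w

omit [∀ w, TopologicalSpace (B w)] in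
/-- [FF18 Lem. 2.2.13] as used at p. 52 l. 5–7, DERIVED over the signature: a Teichmüller lift `[z]` with `|z|_{ℂ_p^♭} ≠ 0` is
non-zero modulo the maximal ideal of every closed classical point (`|ψ_{y}([z])|_{K_y} = |z|_{ℂ_p^♭}`, `|0|_{K_y} = 0`). [folklore] -/
theorem resid_teich_ne_zero {w : A.V} {z : (𝔇.lift w).Cflat} (hz : (𝔇.lift w).absFlat z ≠ 0) (y : A.Y w) :
    (𝔇.lift w).resid y ((𝔇.lift w).teich z) ≠ 0 := fun h =>
  hz (by rw [← (𝔇.lift w).absK_teich y z]; exact h ▸ 𝔇.absK_zero w y)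

/-- **[J-III] Lemma 6.9.1 (Non-degeneracy; p. 51 l. 45–55, proof p. 52 l. 1–13)**: «Let `m_1,…,m_{ℓ⋇}` be closed maximal ideals of `B_E`.
Let `τ : B_E^{ℓ⋇} → ∏_j B_E/m_j` be the homomorphism given using the natural surjection `τ_j : B_E → B_E/m_j` for each `j`. Then the
image `τ(Θ̃^{B_E}_Joshi) ≠ (0,0,…,0)`. Proof. It suffices to note that `Θ̃^{B_E}_Joshi` contains elements of the form `Ξ^{z_1,…,z_{ℓ⋇}}_{0,z,w} =
([z_1],…,[z_{ℓ⋇}])` and by [FF18 Lem. 2.2.13] … the image of any Teichmüller lift `[z]` … is non-zero in `B_E/m_j`.» PROVED over the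
signature, reading «`≠ (0,…,0)`» as «some element of the locus has non-zero image» and the closed maximal ideals as the
`𝔪_{y_j}` of closed classical points `y_1,…,y_{ℓ⋇}` (their parametrisation in T-10's datum); the inputs `Σ̃_{L′} ≠ ∅`, existence
of Teichmüller lifts, `ξ_1 ≠ 0` (so `|z_j| ≠ 0`) and `ℓ⋇ ≥ 1` are explicit. At `w ∉ V^{odd,ss}` the witness is `([1],…,[1])`.
[claim: Joshi2024ATS3, status: disputed] -/
theorem lem691 (hT : ∀ w, (𝔇.lift w).TeichLiftExists) (hne : A.adelicAnsatz.Nonempty) (hl : 0 < A.lstar) (w : A.V)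
    (y : Fin A.lstar → A.Y w) :
    ∃ Ξ ∈ 𝔇.thetaLocusBEenl Γ w, (fun j => (𝔇.lift w).resid (y j) (Ξ j)) ≠ 0 := by
  obtain ⟨z, hz⟩ := hne
  set j₀ : Fin A.lstar := ⟨0, hl⟩
  by_cases hw : w ∈ A.Voddss
  · choose x hx using fun j => ((𝔇.lift w).teichLiftExists_iff.1 (hT w)) (A.wComponent z w j)
    have hmem : (𝔇.lift w).admissibleLift (A.wComponent z w) x 0 ∈ 𝔇.liftsAt w z := by
      rw [𝔇.liftsAt_of_mem hw]
      exact ⟨A.wComponent_mem_localAnsatz hz hw, 0, x, hx, rfl⟩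
    refine ⟨_, 𝔇.thetaLocusBE_subset_thetaLocusBEenl Γ w (𝔇.liftsAt_subset_thetaLocusBE w hz hmem), fun h => ?_⟩
    have h0 : (𝔇.lift w).resid (y j₀) ((𝔇.lift w).teich (x j₀)) = 0 := by
      have := congr_fun h j₀
      simpa only [ThetaLiftDatum.admissibleLift, zero_smul, add_zero, Pi.zero_apply] using this
    refine 𝔇.resid_teich_ne_zero (z := x j₀) ?_ (y j₀) h0
    rw [(𝔇.lift w).absFlat_eq_of_isTeichLift (hx j₀)]
    exact (𝔇.absK_xi_pos w _).ne'
  · refine ⟨𝔇.trivialLift w, 𝔇.thetaLocusBE_subset_thetaLocusBEenl Γ w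
      (𝔇.liftsAt_subset_thetaLocusBE w hz (by rw [𝔇.liftsAt_of_not_mem hw]; exact rfl)), fun h => ?_⟩
    have h0 : (𝔇.lift w).resid (y j₀) 1 = 0 := by
      have := congr_fun h j₀
      simpa only [trivialLift, 𝔇.teich_oneFlat, Pi.zero_apply] using this
    rw [map_one] at h0
    exact Ideal.Quotient.zero_ne_one_iff.2 ((𝔇.lift w).m_isMaximal (y j₀)).ne_top h0.symm

/-- Lem. 6.9.1 in the set form «`τ(Θ̃^{B_E}_Joshi) ≠ {(0,…,0)}`». [folklore] -/
theorem lem691_image_ne (hT : ∀ w, (𝔇.lift w).TeichLiftExists) (hne : A.adelicAnsatz.Nonempty) (hl : 0 < A.lstar)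
    (w : A.V) (y : Fin A.lstar → A.Y w) :
    (fun (Ξ : Fin A.lstar → B w) (j : Fin A.lstar) => (𝔇.lift w).resid (y j) (Ξ j)) '' 𝔇.thetaLocusBEenl Γ w ≠ {0} := by
  intro h
  obtain ⟨Ξ, hΞ, hne0⟩ := 𝔇.lem691 Γ hT hne hl w y
  have hmem := mem_image_of_mem (fun (Ξ : Fin A.lstar → B w) (j : Fin A.lstar) => (𝔇.lift w).resid (y j) (Ξ j)) hΞ
  rw [h] at hmem
  exact hne0 hmem

end Enlargement

/-! ## §6 §6.9.1 the adelic rings; Definition 6.10.2 the ADELIC theta-values locus; (6.10.4); §6.10.2 descent -/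

/-- **[J-III] §6.9.1 (6.9.1.1) = (6.10.1) (p. 52 l. 13–22, l. 44–55), the ADELIC RING `B_{L′} = ∏_{w ∈ V_{L′}} B_{L′_w}`** («the adelic
topological ring constructed in [Joshi 2023a, Def. 4.5.1]»; only the product RING is typed, not its topology).
[claim: Joshi2024ATS3, status: disputed] -/
abbrev adelicRing (_𝔇 : AdelicLiftDatum A OE B) : Type := ∀ w : A.V, B w

/-- **(6.9.1.2) (p. 52 l. 23–42)**: the variant `B̃_{L′} = ∏_{w ∈ V_{L′}} B̃_{L′_w} = ∏_w (B ⊗_{ℚ_p} L′_w)` (type of families).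
[claim: Joshi2024ATS3, status: disputed] -/
abbrev adelicRingTil : Type := ∀ w : A.V, 𝔇.Btil w

/-- `B_{L′} → B̃_{L′}`, the product of the diagonal embeddings (5.2.5.5). [claim: Joshi2024ATS3, status: disputed] -/
def toTil (x : 𝔇.adelicRing) : 𝔇.adelicRingTil := fun w => 𝔇.toBtil w (x w)

/-- The ambient set `B_{L′}^{ℓ⋇} ≅ ∏_{w ∈ V_{L′}} B_{L′_w}^{ℓ⋇}` of Def. 6.10.2 (p. 52 l. 60–70), as a type of families (slot T-12's `Tuple`).
[claim: Joshi2024ATS3, status: disputed] -/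
abbrev Tuple (_𝔇 : AdelicLiftDatum A OE B) : Type := ∀ w : A.V, Fin A.lstar → B w

/-- **[J-III] Definition 6.10.2, (6.10.3) (p. 52 l. 56–70), THE ADELIC THETA-VALUES LOCUS `Θ̃^{B_{L′}}_Joshi`**: «the set of all
`Ξ_z = (Ξ_{z,w})_{w ∈ V_{L′}} ∈ B_{L′}^{ℓ⋇}`, for each `z ∈ Σ̃_{L′}`. Hence `Θ̃^{B_{L′}}_Joshi = {(Ξ_{z,w})_{w ∈ V_{L′}} ∈ B_{L′}^{ℓ⋇} : z ∈ Σ̃_{L′}} ⊂ B_{L′}^{ℓ⋇}`.» Typed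
on `∏_w B_{L′_w}^{ℓ⋇}` as the families choosing, for ONE common `z ∈ Σ̃_{L′}`, a lift `Ξ_{z,w}` at every place (admissible at `w ∈ V^{odd,ss}`,
trivial elsewhere; T-10's `adelicLocus` = §6.2's product assembly) — the choices `([z_j], λ)` suppressed by the notation `Ξ_{z,w}`
(p. 48 l. 1–7) range freely and independently in `w` (the reading used by the proof of Thm. 7.3.1, p. 55 l. 38–45, p. 56 l. 38–41).
Stated, as printed, over the lifts of Def. 6.6.1.1, NOT over the §6.7-enlarged local sets. [claim: Joshi2024ATS3, status: disputed] -/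
def thetaLocusBL : Set 𝔇.Tuple := ⋃ z ∈ A.adelicAnsatz, adelicLocus fun w => 𝔇.liftsAt w z

/-- Membership in `Θ̃^{B_{L′}}_Joshi`: one Ansatz point `z` serving every place. [folklore] -/
theorem mem_thetaLocusBL_iff (Ξ : 𝔇.Tuple) : Ξ ∈ 𝔇.thetaLocusBL ↔ ∃ z ∈ A.adelicAnsatz, ∀ w, Ξ w ∈ 𝔇.liftsAt w z := by
  simp only [thetaLocusBL, mem_iUnion, mem_adelicLocus_iff, exists_prop]

/-- (6.5.1) read on the adelic locus (slot T-12's `Xi_off`): off `V^{odd,ss}` every element of `Θ̃^{B_{L′}}_Joshi` is `([1],…,[1])`. [folklore] -/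
theorem apply_eq_trivialLift_of_mem {Ξ : 𝔇.Tuple} (hΞ : Ξ ∈ 𝔇.thetaLocusBL) {w : A.V} (hw : w ∉ A.Voddss) :
    Ξ w = 𝔇.trivialLift w := by
  obtain ⟨z, -, hz⟩ := (𝔇.mem_thetaLocusBL_iff Ξ).1 hΞ
  simpa only [𝔇.liftsAt_of_not_mem hw, mem_singleton_iff] using hz w

/-- `Θ̃^{B_{L′}}_Joshi ≠ ∅` granted `Σ̃_{L′} ≠ ∅` and Teichmüller lifts («contains elements of the form `Ξ_{z_Θ}`», p. 55 l. 38–41). [folklore] -/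
theorem thetaLocusBL_nonempty (hT : ∀ w, (𝔇.lift w).TeichLiftExists) (hne : A.adelicAnsatz.Nonempty) :
    𝔇.thetaLocusBL.Nonempty := by
  obtain ⟨z, hz⟩ := hne
  choose Ξ hΞ using fun w => 𝔇.liftsAt_nonempty hT hz w
  exact ⟨Ξ, (𝔇.mem_thetaLocusBL_iff Ξ).2 ⟨z, hz, hΞ⟩⟩

/-- «the local (i.e. `w`) component `Θ̃^{B_{L′_w}}_Joshi` of the adelic theta-values locus» (p. 56 l. 38–44): the projection to the
place `w`. [claim: Joshi2024ATS3, status: disputed] -/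
def localComponent (w : A.V) : Set (Fin A.lstar → B w) := (fun Ξ : 𝔇.Tuple => Ξ w) '' 𝔇.thetaLocusBL

/-- The local component at `w` lies in the locus `Θ̃^{B_E}_Joshi` of Def. 6.6.1.1. [folklore] -/
theorem localComponent_subset (w : A.V) : 𝔇.localComponent w ⊆ 𝔇.thetaLocusBE w := by
  rintro _ ⟨Ξ, hΞ, rfl⟩
  obtain ⟨z, hz, h⟩ := (𝔇.mem_thetaLocusBL_iff Ξ).1 hΞ
  exact 𝔇.liftsAt_subset_thetaLocusBE w hz (h w)

/-- … and EQUALS it granted lifts exist at the other places: «`Ξ_{0,z,w}` runs through the local component» (p. 56 l. 38–41).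
PROVED. [folklore] -/
theorem localComponent_eq (hT : ∀ w, (𝔇.lift w).TeichLiftExists) (w : A.V) :
    𝔇.localComponent w = 𝔇.thetaLocusBE w := by
  classical
  refine Subset.antisymm (𝔇.localComponent_subset w) fun Ξw hΞw => ?_
  obtain ⟨z, hz, hzw⟩ := mem_iUnion₂.1 hΞw
  choose Ξ hΞ using fun w' => 𝔇.liftsAt_nonempty hT hz w'
  refine ⟨Function.update Ξ w Ξw, (𝔇.mem_thetaLocusBL_iff _).2 ⟨z, hz, fun w' => ?_⟩, Function.update_self w Ξw Ξ⟩
  by_cases h : w' = w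
  · subst h; rw [Function.update_self]; exact hzw
  · rw [Function.update_of_ne h]; exact hΞ w'

/-- **(6.10.4) (p. 53 l. 1–10)**: «one can also embed `Θ̃^{B_{L′}}_Joshi ⊂ B̃_{L′}^{ℓ⋇}` and I will write `Θ̃^{B̃_{L′}}_Joshi` for the image».
[claim: Joshi2024ATS3, status: disputed] -/
def thetaLocusBLtil : Set (∀ w : A.V, Fin A.lstar → 𝔇.Btil w) :=
  (fun (Ξ : 𝔇.Tuple) w j => 𝔇.toBtil w (Ξ w j)) '' 𝔇.thetaLocusBL

/-- **§6.10.2 Descending to `L_mod` (p. 53 l. 19–28)**, the descent MAP on `B_{L′}^{ℓ⋇}`: «the bijection `V_{L_mod} ≃ V ⊂ V_{L′}`» followed by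
«the trace morphism `B_{L′_w} → B_{L_mod,v}`» for the unique `w ∈ V` over `v`, coordinatewise (T-10's `ModuliDescentDatum.descend` is the
same move on arithmeticoids). [claim: Joshi2024ATS3, status: disputed] -/
def descend (Ξ : 𝔇.Tuple) : ∀ v : 𝔇.Vmod, Fin A.lstar → 𝔇.Bmod v := fun v j => 𝔇.trace v (Ξ (𝔇.sel v) j)

/-- **§6.10.2, «the descent of the theta-value loci to `L_mod`»** (p. 53 l. 26–28): the image of `Θ̃^{B_{L′}}_Joshi` in `B_{L_mod}^{ℓ⋇}`.
[claim: Joshi2024ATS3, status: disputed] -/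
def thetaLocusBLmod : Set (∀ v : 𝔇.Vmod, Fin A.lstar → 𝔇.Bmod v) := 𝔇.descend '' 𝔇.thetaLocusBL

/-! ## §6.10.1 (READING, p. 53 l. 11–18) — recorded, not typed
«each admissible theta-values-lift `Ξ_z` is the additive analog of Mochizuki's Θ-pilot object (see [IUTchIII Def. 3.8])»;
«Mochizuki's theta-values set `Θ̃_Mochizuki`, according to [IUTchIII Cor. 3.12], is the “holomorphic hull” of the collection of all
possible Θ-pilot objects»; «In §9, I will demonstrate that each `Ξ_z ∈ Θ̃^{B_{L′}}_Joshi` has a Galois cohomological manifestation and this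
cohomological object will be a Θ-Pilot in the sense of [Mochizuki 2021c]» (forward reference to Thm.-Def. 9.8.1.1, slot T-22). On Joshi's
side «the collection of all Θ-pilot analogs» IS `thetaLocusBL`; its binding to our `Summit.ABC.IUTFork.Thm311.MRData.Ψ` /
`Cor312.Setting.possibleImages` is OBJECTS.tsv O-023 / E-PLAN D-03 (`Joshi/Dictionary.lean`: `Dictionary.datum`, `BaseIsThetaPilot`). -/

end AdelicLiftDatum

end Summit.ABC.IUTFork.Joshi.ATS3

end
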